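import Summits.QuantumFields.QCD.Theorems.HeatSlicedQuarksRobustYangMillsHandoverStubDiracMatrixSourceTimeSlice
import Summits.QuantumFields.QCD.Theorems.HeatSlicedQuarksRobustYangMillsHandoverStubProjChainDetHasDerivAtSource
import Summits.QuantumFields.QCD.Theorems.HeatSlicedQuarksRobustYangMillsHandoverStubWilsonChainUndressInsertion
import Summits.QuantumFields.QCD.Theorems.HeatSlicedQuarksRobustYangMillsHandoverStubFlavourChainDressedCore
import Summits.QuantumFields.QCD.Theorems.QuarksAsStableActionStableActionBridgeSupertraceTransferForm
import HarnessLib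

/-!
# Stub `stub_det_diracMatrix_source_hasDerivAt_smit` of line `pin-the-infimum`
(crux `RobustYangMillsHandover`, 8892)

E2 (fermionic insertions in Lüscher's transfer form), layer E2-b — **the per-background
deliverable**: for every `SU(3)` gauge field `U` on the four-torus `(ℤ/L)⁴`, `N_f` flavours of
`r = 1` Wilson quarks with masses `mq f > −1`, a time slice `t₀` and an arbitrary source block `Jh`
coupling the quark variables of that ONE slice, the `s`-derivative at `0` of `det (D(U) − s J^{(t₀)})`
is the supertrace of Lüscher's transfer product (capstone B `det_diracMatrix_eq_supertrace_fermionSliceOp`,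
`det D(U) = Σ_s (−1)^{#s} ⟨s| ∏_i T̂_F(U_i) Γ(G_{g_i}) |s⟩`) with ONE link-free Fock insertion in front
of the slice-`t₀` factor: `𝒦_{t₀} = dΓ(V⁻¹ K̂_J V) − tr (Jh Â⁻¹ P̂⁻) · 1`,
`K̂_J = (−P̂⁺ + P̂⁺ (γ₄ D̂) Â⁻¹ P̂⁻ + Â⁻¹ P̂⁻) · Jh · (P̂⁻ + P̂⁺ V M_F⁻¹ V⁻¹)` — slice-`t₀` data only
(Smit's `Â = sliceMassHop`, `D̂ = sliceDiracKinetic`, `M_F = fermionSliceMatrix`, `P̂± = 1 ⊗ ½(1 ± γ₄)`,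
`V = 1 ⊗ γ₄γ₅`, `V⁻¹ = 1 ⊗ γ₅γ₄`).

## Proof (assembly of landed bricks)

* γ0 `stub_diracMatrix_source_timeSlice`: `det (D − s J^{(t₀)})` is the determinant of the
  `N_f`-flavour projector chain with slice operator `A_{t₀} − s Jsl`, `Jsl = reindex e_Nf e_Nf Jh`,
  `e_Nf = (Equiv.prodAssoc flavour site (colour × spin)).symm`, plus the chain hypotheses;
* F1 `stub_projChain_det_hasDerivAt_source`: the one-slice source derivative
  `(∏ det E_t) · STr ∏_i (𝒥_i Γ(N_i))` (invertibility of `F_{t₀}`: conjunct 3 of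
  `stub_chainBlock_insertion_algebra`, read through determinants);
* F2 `stub_wilsonChain_undress_insertion` with `C_t := A_t − B̂_t`: link-free insertion, cores `M′_i W_i`;
* the dictionary `stub_flavourChain_slice_dictionary` / `stub_flavourChain_dressedCore`
  (`P±, W, A − B̂, B̂⁻¹, M′, M′ᵢ` as `reindex e_Nf e_Nf` of Smit's objects, `det E_t = det Â_t²`);
* `StubDetDiracMatrixSourceHasDerivAtSmit.supertrace_collapse`: the reindexings collapse, the constant
  spin rotation `V` is undressed under the supertrace (`stub_supertrace_undress_insert` with
  `S ≡ reindex V`; the insertion is conjugated by `Γ(V)`), and the Dirac-sea scalars `det Â_i²` are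
  pushed onto the factors `T̂_F(U_i) = det Â_i² · Γ(M_F(U_i))`.

Pure theorem file (no definitions).  References: M. Lüscher, Comm. Math. Phys. 54 (1977) 283–292;
J. Smit, *Introduction to Quantum Fields on a Lattice* (CUP 2002/2023), §6.5 (6.91), App. C;
I. Montvay, G. Münster, *Quantum Fields on a Lattice* (CUP 1994), §4.2.3, §5.1.
-/

namespace Summit.QuantumFields.QCD.Cruxes.RobustYangMillsHandover.PinTheInfimum

open Literature.MathematicalPhysics.QuantumLattice Literature.MathematicalPhysics.QuantumFieldTheory
open Literature.Probability.LatticeModels (TorusSite)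
open Summit.QuantumFields.QCD.Cruxes.StableActionBridge.Sketch
open Summit.QuantumFields.QCD.Cruxes.StableActionBridge.Sketch.FockLiftPosDef
open Summit.QuantumFields.QCD.Cruxes.StableActionBridge.Sketch.FermionSliceOpCovariance

namespace StubDetDiracMatrixSourceHasDerivAtSmit

/-- Composite reindexing: `reindex (f ∘ g) (reindex f⁻¹ X) = reindex g X`. [folklore] -/
theorem reindex_trans_reindex_symm {k m n : Type*} (f : k ≃ m) (g : m ≃ n) (X : Matrix m m ℂ) :
    Matrix.reindex (f.trans g) (f.trans g) (Matrix.reindex f.symm f.symm X) = Matrix.reindex g g X := by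
  ext i j
  simp only [Matrix.reindex_apply, Matrix.submatrix_apply, Equiv.symm_trans_apply, Equiv.symm_symm,
    Equiv.apply_symm_apply]

section Scalars

variable {ι : Type*} [Fintype ι] [DecidableEq ι]

/-- `∏_i Q_i (c_i • Y_i · Z_i) = (∏_i c_i) • ∏_i Q_i (Y_i Z_i)` for ordered list products (central scalars). [folklore] -/
theorem prod_map_mul_smul_mul (c : ℕ → ℂ) (Q Y Z : ℕ → Matrix ι ι ℂ) :
    ∀ l : List ℕ, (l.map fun i => Q i * (c i • Y i * Z i)).prod =
      (l.map c).prod • (l.map fun i => Q i * (Y i * Z i)).prod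
  | [] => by rw [List.map_nil, List.map_nil, List.map_nil, List.prod_nil, List.prod_nil, one_smul]
  | a :: l => by
    rw [List.map_cons, List.prod_cons, prod_map_mul_smul_mul c Q Y Z l, List.map_cons, List.prod_cons,
      List.map_cons, List.prod_cons]
    simp only [Matrix.smul_mul, Matrix.mul_smul, smul_smul, Matrix.mul_assoc, mul_comm (c a)]

/-- Supertrace form: `(∏_i c_i) · STr ∏_i Q_i (Y_i Z_i) = STr ∏_i Q_i (c_i • Y_i · Z_i)`. [folklore] -/
theorem supertrace_prod_smul (c : ℕ → ℂ) (Q Y Z : ℕ → Matrix (Finset ι) (Finset ι) ℂ) (l : List ℕ) :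
    (l.map c).prod * ∑ S : Finset ι, (-1 : ℂ) ^ S.card * (l.map fun i => Q i * (Y i * Z i)).prod S S =
      ∑ S : Finset ι, (-1 : ℂ) ^ S.card * (l.map fun i => Q i * (c i • Y i * Z i)).prod S S := by
  rw [prod_map_mul_smul_mul, Finset.mul_sum]
  exact Finset.sum_congr rfl fun S _ => by rw [Matrix.smul_apply, smul_eq_mul]; ring

end Scalars

section Collapse

variable {k m n : Type*} [Fintype k] [DecidableEq k] [Fintype m] [DecidableEq m] [LinearOrder n] [Fintype n]

/-- **Undressing a constant one-particle similarity under the supertrace with an insertion.**  For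
`Vᵢ V = V Vᵢ = 1`, `STr ∏_i (𝒬_i Γ(reindex (V X_i Vᵢ))) = STr ∏_i (𝒬′_i Γ(reindex X_i))` where the
insertion `𝒬_{t₀} = dΓ(reindex K) − c·1` is conjugated to `𝒬′_{t₀} = dΓ(reindex (Vᵢ K V)) − c·1`
(`stub_supertrace_undress_insert` with the constant family `S ≡ reindex V`, and
`Γ(gᵢ)(dΓ(Z) − c)Γ(g) = dΓ(gᵢ Z g) − c`). [cite: Luscher1977, pp. 283–292] -/
theorem supertrace_undress_const (T : ℕ) (g : m ≃ n) (t₀ : ZMod T) (V Vi K : Matrix m m ℂ) (cJ : ℂ)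
    (X : ZMod T → Matrix m m ℂ) (hViV : Vi * V = 1) (hVVi : V * Vi = 1) :
    ∑ S : Finset n, (-1 : ℂ) ^ S.card *
        (((List.range T).map fun i : ℕ =>
          (if (i : ZMod T) = t₀ then
              dGamma (Matrix.reindex g g K) - cJ • (1 : Matrix (Finset n) (Finset n) ℂ)
            else 1) *
          fockLift (Matrix.reindex g g (V * X (i : ZMod T) * Vi))).prod) S S =
      ∑ S : Finset n, (-1 : ℂ) ^ S.card *
        (((List.range T).map fun i : ℕ =>
          (if (i : ZMod T) = t₀ then
              dGamma (Matrix.reindex g g (Vi * K * V)) - cJ • (1 : Matrix (Finset n) (Finset n) ℂ)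
            else 1) *
          fockLift (Matrix.reindex g g (X (i : ZMod T)))).prod) S S := by
  have hVV : Matrix.reindex g g V * Matrix.reindex g g Vi = 1 := by
    rw [← reindex_mul_reindex, hVVi, StubWilsonChainUndressInsertion.reindex_one]
  have hViV' : Matrix.reindex g g Vi * Matrix.reindex g g V = 1 := by
    rw [← reindex_mul_reindex, hViV, StubWilsonChainUndressInsertion.reindex_one]
  have hdet : IsUnit (Matrix.reindex g g V).det := Matrix.isUnit_det_of_right_inverse hVV
  have hinv : (Matrix.reindex g g V)⁻¹ = Matrix.reindex g g Vi := Matrix.inv_eq_right_inv hVV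
  -- factorising the dressed transfer factors
  have hfac : ∀ i : ℕ,
      (if (i : ZMod T) = t₀ then
          dGamma (Matrix.reindex g g K) - cJ • (1 : Matrix (Finset n) (Finset n) ℂ) else 1) *
        fockLift (Matrix.reindex g g (V * X (i : ZMod T) * Vi)) =
      (if (i : ZMod T) = t₀ then
          dGamma (Matrix.reindex g g K) - cJ • (1 : Matrix (Finset n) (Finset n) ℂ) else 1) *
        fockLift (Matrix.reindex g g V) * fockLift (Matrix.reindex g g (X (i : ZMod T))) *
        fockLift (Matrix.reindex g g V)⁻¹ := by
    intro i
    rw [hinv, reindex_mul_reindex, reindex_mul_reindex, fockLift_mul, fockLift_mul]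
    simp only [Matrix.mul_assoc]
  -- the conjugated insertions
  have hQ : ∀ i : ℕ,
      fockLift (Matrix.reindex g g V)⁻¹ *
          (if (i : ZMod T) = t₀ then
              dGamma (Matrix.reindex g g K) - cJ • (1 : Matrix (Finset n) (Finset n) ℂ) else 1) *
        fockLift (Matrix.reindex g g V) =
      (if (i : ZMod T) = t₀ then
          dGamma (Matrix.reindex g g (Vi * K * V)) - cJ • (1 : Matrix (Finset n) (Finset n) ℂ) else 1) := by
    intro i
    by_cases h : (i : ZMod T) = t₀
    · rw [if_pos h, if_pos h, hinv, StubWilsonChainUndressInsertion.fockLift_conj_dGamma_sub_smul hViV',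
        ← reindex_mul_reindex, ← reindex_mul_reindex]
    · rw [if_neg h, if_neg h, Matrix.mul_one, hinv, ← fockLift_mul, hViV', fockLift_one]
  have hund := StubSupertraceUndressInsert.supertrace_undress_insert T (fun _ => Matrix.reindex g g V)
    (fun t => if t = t₀ then
      dGamma (Matrix.reindex g g K) - cJ • (1 : Matrix (Finset n) (Finset n) ℂ) else 1)
    (fun t => fockLift (Matrix.reindex g g (X t))) (fun _ => hdet)
  simp only [hfac]
  rw [hund]
  simp only [hQ]

omit [DecidableEq m] in
/-- **Splitting the transfer factors and distributing the Dirac-sea scalars**: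
`(∏_i c_i) · STr ∏_i 𝒬_i Γ(reindex (M_i G_i)) = STr ∏_i 𝒬_i ((c_i • Γ(reindex M_i)) Γ(reindex G_i))`
(`Γ ∘ reindex` multiplicative, scalars central). [folklore] -/
theorem supertrace_split_smul (T : ℕ) (g : m ≃ n) (t₀ : ZMod T) (Kq : Matrix m m ℂ) (cJ : ℂ)
    (MF G : ZMod T → Matrix m m ℂ) (c : ZMod T → ℂ) :
    ((List.range T).map fun i : ℕ => c (i : ZMod T)).prod *
      ∑ S : Finset n, (-1 : ℂ) ^ S.card *
        (((List.range T).map fun i : ℕ =>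
          (if (i : ZMod T) = t₀ then
              dGamma (Matrix.reindex g g Kq) - cJ • (1 : Matrix (Finset n) (Finset n) ℂ)
            else 1) *
          fockLift (Matrix.reindex g g (MF (i : ZMod T) * G (i : ZMod T)))).prod) S S =
      ∑ S : Finset n, (-1 : ℂ) ^ S.card *
        (((List.range T).map fun i : ℕ =>
          (if (i : ZMod T) = t₀ then
              dGamma (Matrix.reindex g g Kq) - cJ • (1 : Matrix (Finset n) (Finset n) ℂ)
            else 1) *
          (c (i : ZMod T) • fockLift (Matrix.reindex g g (MF (i : ZMod T))) *
            fockLift (Matrix.reindex g g (G (i : ZMod T))))).prod) S S := by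
  simp only [reindex_mul_reindex, fockLift_mul]
  exact supertrace_prod_smul (fun i : ℕ => c (i : ZMod T))
    (fun i : ℕ => if (i : ZMod T) = t₀ then
      dGamma (Matrix.reindex g g Kq) - cJ • (1 : Matrix (Finset n) (Finset n) ℂ) else 1)
    (fun i : ℕ => fockLift (Matrix.reindex g g (MF (i : ZMod T))))
    (fun i : ℕ => fockLift (Matrix.reindex g g (G (i : ZMod T)))) (List.range T)

/-- **Collapse of the undressed, dictionary-substituted supertrace to Smit's vocabulary.**  After the
`N_f`-flavour dictionary every one-particle matrix of the F2 output is `reindex f⁻¹` of a matrix on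
the slice quark modes `m`, carried to the Fock index along `f ∘ g`; the reindexings collapse to
`reindex g`, the constant spin rotation `V` (with `Vᵢ V = V Vᵢ = 1`, `G_i Vᵢ = Vᵢ G_i`) is undressed
under the supertrace (conjugating the insertion), and the scalars `c_i` are distributed onto the
transfer factors. [cite: Luscher1977, pp. 283–292] [cite: Smit2023, §6.5 (6.91)] -/
theorem supertrace_collapse (T : ℕ) (f : k ≃ m) (g : m ≃ n) (t₀ : ZMod T)
    (Pp Pm V Vi J Ct Bit MFit : Matrix m m ℂ) (MF G : ZMod T → Matrix m m ℂ) (c : ZMod T → ℂ)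
    (hViV : Vi * V = 1) (hVVi : V * Vi = 1) (hGV : ∀ t, G t * Vi = Vi * G t) :
    ((List.range T).map fun i : ℕ => c (i : ZMod T)).prod *
      ∑ S : Finset n, (-1 : ℂ) ^ S.card *
        (((List.range T).map fun i : ℕ =>
          (if (i : ZMod T) = t₀ then
              dGamma (Matrix.reindex (f.trans g) (f.trans g)
                ((-Matrix.reindex f.symm f.symm Pp +
                      Matrix.reindex f.symm f.symm Pp * Matrix.reindex f.symm f.symm Ct *
                        Matrix.reindex f.symm f.symm Bit * Matrix.reindex f.symm f.symm Pm +
                    Matrix.reindex f.symm f.symm Bit * Matrix.reindex f.symm f.symm Pm) *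
                  Matrix.reindex f.symm f.symm J *
                  (Matrix.reindex f.symm f.symm Pm +
                    Matrix.reindex f.symm f.symm Pp * Matrix.reindex f.symm f.symm (V * MFit * Vi)))) -
              (Matrix.reindex f.symm f.symm J * Matrix.reindex f.symm f.symm Bit *
                  Matrix.reindex f.symm f.symm Pm).trace • (1 : Matrix (Finset n) (Finset n) ℂ)
            else 1) *
          fockLift (Matrix.reindex (f.trans g) (f.trans g)
            (Matrix.reindex f.symm f.symm (V * MF (i : ZMod T) * Vi) *
              Matrix.reindex f.symm f.symm (G (i : ZMod T))))).prod) S S =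
      ∑ S : Finset n, (-1 : ℂ) ^ S.card *
        (((List.range T).map fun i : ℕ =>
          (if (i : ZMod T) = t₀ then
              dGamma (Matrix.reindex g g
                (Vi * ((-Pp + Pp * Ct * Bit * Pm + Bit * Pm) * J * (Pm + Pp * (V * MFit * Vi))) * V)) -
              (J * Bit * Pm).trace • (1 : Matrix (Finset n) (Finset n) ℂ)
            else 1) *
          (c (i : ZMod T) • fockLift (Matrix.reindex g g (MF (i : ZMod T))) *
            fockLift (Matrix.reindex g g (G (i : ZMod T))))).prod) S S := by
  -- the trace is invariant under reindexing (cf. `TubeZeroFreeChannel.trace_reindex_eq`, Yang–Mills tree)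
  have htr : ∀ X : Matrix m m ℂ, (Matrix.reindex f.symm f.symm X).trace = X.trace := fun X => by
    simp only [Matrix.trace, Matrix.diag_apply, Matrix.reindex_apply, Matrix.submatrix_apply]
    exact f.symm.symm.sum_comp (fun i => X i i)
  -- collapse the reindexings
  simp only [← Matrix.coe_reindexAlgEquiv ℂ ℂ f.symm, ← map_mul, ← map_add, ← map_neg]
  simp only [Matrix.coe_reindexAlgEquiv, reindex_trans_reindex_symm f g, htr]
  -- `V M_F Vᵢ G = V (M_F G) Vᵢ`
  have hX : ∀ t, V * MF t * Vi * G t = V * (MF t * G t) * Vi := fun t => by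
    rw [Matrix.mul_assoc (V * MF t) Vi (G t), ← hGV t, ← Matrix.mul_assoc, Matrix.mul_assoc V (MF t) (G t)]
  simp only [hX]
  rw [supertrace_undress_const T g t₀ V Vi _ _ (fun t => MF t * G t) hViV hVVi]
  exact supertrace_split_smul T g t₀ _ _ MF G c

end Collapse

end StubDetDiracMatrixSourceHasDerivAtSmit


/-- **E2-b (per background, Smit vocabulary): the source derivative of the `N_f`-flavour Wilson–Dirac
determinant is the supertrace of Lüscher's transfer product with ONE link-free Fock insertion.**
For an `SU(3)` gauge field `U` on `(ℤ/L)⁴`, masses `mq f > −1`, a time slice `t₀` and an arbitrary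
source block `Jh` on the quark variables of that slice,
`d/ds|₀ det (D(U) − s J^{(t₀)}) = Σ_S (−1)^{#S} ⟨S| ∏_i 𝒦_i · (T̂_F(U_i) Γ(G_{g_i})) |S⟩` with
`𝒦_i = 1` for `i ≠ t₀` and `𝒦_{t₀} = dΓ(V⁻¹ K̂_J V) − tr(Jh Â⁻¹ P̂⁻)·1`,
`K̂_J = (−P̂⁺ + P̂⁺(γ₄D̂)Â⁻¹P̂⁻ + Â⁻¹P̂⁻) Jh (P̂⁻ + P̂⁺ V M_F⁻¹ V⁻¹)` (slice-`t₀` data only; registered stub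
signature verbatim).  Assembly of γ0, F1, F2, the `N_f`-flavour dictionary and
`StubDetDiracMatrixSourceHasDerivAtSmit.supertrace_collapse` (module docstring).
[cite: Luscher1977, pp. 283–292] [cite: Smit2023, §6.5 (6.91)] -/
theorem stub_det_diracMatrix_source_hasDerivAt_smit :
    ∀ (Nf L : ℕ) [NeZero L] (U : GaugeConfig 4 L (Matrix.specialUnitaryGroup (Fin 3) ℂ)) (mq : Fin Nf → ℝ),
      (∀ f, -1 < mq f) → ∀ (t₀ : ZMod L) (Jh : Matrix (SliceQuarkVar Nf L) (SliceQuarkVar Nf L) ℂ),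
      HasDerivAt (fun s : ℝ => (diracMatrix U mq - (s : ℂ) • Matrix.reindex quarkEquiv quarkEquiv
          (Matrix.of fun v w : QuarkVar Nf L => if v.2.1 0 = t₀ ∧ w.2.1 0 = t₀ then
            Jh (v.1, (Fin.tail v.2.1, v.2.2)) (w.1, (Fin.tail w.2.1, w.2.2)) else 0)).det)
        (∑ S : Finset (SliceFermiIdx Nf L), (-1 : ℂ) ^ S.card *
          ((((List.range L).map fun i : ℕ =>
            (if (i : ZMod L) = t₀ then
                dGamma (Matrix.reindex sliceQuarkEquiv sliceQuarkEquiv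
                  (sliceKron (Nf := Nf) (S := L) 1 (gammaFive * euclideanGamma 0) *
                    ((-sliceKron (Nf := Nf) (S := L) 1 timeProjPlus +
                        sliceKron (Nf := Nf) (S := L) 1 timeProjPlus *
                          (sliceKron (Nf := Nf) (S := L) 1 (euclideanGamma 0) *
                            sliceDiracKinetic (fun e : Edge 3 L => U ((Fin.cons t₀ e.1 : TorusSite 4 L), e.2.succ))) *
                          sliceKron ((sliceMassHop (fun e : Edge 3 L => U ((Fin.cons t₀ e.1 : TorusSite 4 L), e.2.succ)) mq)⁻¹) 1 *
                          sliceKron (Nf := Nf) (S := L) 1 timeProjMinus +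
                        sliceKron ((sliceMassHop (fun e : Edge 3 L => U ((Fin.cons t₀ e.1 : TorusSite 4 L), e.2.succ)) mq)⁻¹) 1 *
                          sliceKron (Nf := Nf) (S := L) 1 timeProjMinus) *
                      Jh *
                      (sliceKron (Nf := Nf) (S := L) 1 timeProjMinus +
                        sliceKron (Nf := Nf) (S := L) 1 timeProjPlus *
                          (sliceKron (Nf := Nf) (S := L) 1 (euclideanGamma 0 * gammaFive) *
                            (fermionSliceMatrix (fun e : Edge 3 L => U ((Fin.cons t₀ e.1 : TorusSite 4 L), e.2.succ)) mq)⁻¹ *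
                            sliceKron (Nf := Nf) (S := L) 1 (gammaFive * euclideanGamma 0)))) *
                    sliceKron (Nf := Nf) (S := L) 1 (euclideanGamma 0 * gammaFive))) -
                (Jh * sliceKron ((sliceMassHop (fun e : Edge 3 L => U ((Fin.cons t₀ e.1 : TorusSite 4 L), e.2.succ)) mq)⁻¹) 1 *
                    sliceKron (Nf := Nf) (S := L) 1 timeProjMinus).trace •
                  (1 : Matrix (Finset (SliceFermiIdx Nf L)) (Finset (SliceFermiIdx Nf L)) ℂ)
              else 1) *
            (fermionSliceOp (fun e : Edge 3 L => U ((Fin.cons (i : ZMod L) e.1 : TorusSite 4 L), e.2.succ)) mq *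
              fockGaugeAct (Nf := Nf) (fun y : TorusSite 3 L => U ((Fin.cons (i : ZMod L) y : TorusSite 4 L), 0)))).prod :
              Matrix (Finset (SliceFermiIdx Nf L)) (Finset (SliceFermiIdx Nf L)) ℂ) S S)) 0 := by
  intro Nf L _ U mq hm t₀ Jh
  /- (0) Notation: the re-association `e_Nf = eA.symm`, the slice data `U_t`, `g_t`, the flavoured
    chain data of γ0 (`stub_diracMatrix_source_timeSlice`) and the spin-blind block `B̂_t`. -/
  set eA := Equiv.prodAssoc (Fin Nf) (TorusSite 3 L) (Fin 3 × Fin 4)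
  set Us : ZMod L → GaugeConfig 3 L (Matrix.specialUnitaryGroup (Fin 3) ℂ) :=
    fun t e => U ((Fin.cons t e.1 : TorusSite 4 L), e.2.succ)
  set gs : ZMod L → TorusSite 3 L → Matrix.specialUnitaryGroup (Fin 3) ℂ :=
    fun t y => U ((Fin.cons t y : TorusSite 4 L), 0)
  set Pp := Matrix.of fun a b : (Fin Nf × TorusSite 3 L) × Fin 3 × Fin 4 =>
    if a.1 = b.1 ∧ a.2.1 = b.2.1 then ((1 / 2 : ℂ) • (1 + euclideanGamma 0)) a.2.2 b.2.2 else 0 with hPp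
  set Pm := Matrix.of fun a b : (Fin Nf × TorusSite 3 L) × Fin 3 × Fin 4 =>
    if a.1 = b.1 ∧ a.2.1 = b.2.1 then ((1 / 2 : ℂ) • (1 - euclideanGamma 0)) a.2.2 b.2.2 else 0 with hPm
  set W := fun t : ZMod L => Matrix.of fun a b : (Fin Nf × TorusSite 3 L) × Fin 3 × Fin 4 =>
    if a.1 = b.1 ∧ a.2.2 = b.2.2 then
      fundamentalRep (Fin 3) (U ((Fin.cons t a.1.2 : TorusSite 4 L), 0)) a.2.1 b.2.1 else 0
  set W' := fun t : ZMod L => Matrix.of fun a b : (Fin Nf × TorusSite 3 L) × Fin 3 × Fin 4 =>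
    if a.1 = b.1 ∧ a.2.2 = b.2.2 then
      fundamentalRep (Fin 3) (U ((Fin.cons t a.1.2 : TorusSite 4 L), 0))⁻¹ a.2.1 b.2.1 else 0
  set A := fun t : ZMod L => Matrix.of fun a b : (Fin Nf × TorusSite 3 L) × Fin 3 × Fin 4 =>
    if a.1.1 = b.1.1 then
      ((if a = b then ((mq a.1.1 + 4 * 1 : ℝ) : ℂ) else 0) -
        (1 / 2 : ℂ) * ∑ j : Fin 3,
          ((if b.1.2 = Literature.MathematicalPhysics.QuantumFieldTheory.Site.shift a.1.2 j then
              (((1 : ℝ) : ℂ) • (1 : Matrix (Fin 4) (Fin 4) ℂ) - euclideanGamma j.succ) a.2.2 b.2.2 *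
                fundamentalRep (Fin 3) (U ((Fin.cons t a.1.2 : TorusSite 4 L), j.succ)) a.2.1 b.2.1 else 0) +
            (if a.1.2 = Literature.MathematicalPhysics.QuantumFieldTheory.Site.shift b.1.2 j then
              (((1 : ℝ) : ℂ) • (1 : Matrix (Fin 4) (Fin 4) ℂ) + euclideanGamma j.succ) a.2.2 b.2.2 *
                fundamentalRep (Fin 3) (U ((Fin.cons t b.1.2 : TorusSite 4 L), j.succ))⁻¹ a.2.1 b.2.1 else 0)))
      else 0
  set Bh := fun t : ZMod L => Matrix.reindex eA.symm eA.symm (sliceKron (sliceMassHop (Us t) mq) 1)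
  /- (1) γ0: the chain hypotheses (the determinant identity is used pointwise in `s` at the end). -/
  have hγ := stub_diracMatrix_source_timeSlice Nf L U mq t₀ (Matrix.reindex eA.symm eA.symm Jh)
  obtain ⟨-, hWPp, hWPm, hW'Pp, hW'Pm, hW'W, hWW'⟩ := hγ 0
  /- (2) the `N_f`-flavour dictionary (W2-3a) and the dressed cores / prefactors (W2-3b). -/
  have hdict := fun t => stub_flavourChain_slice_dictionary Nf L U mq t
  have hdPp : Pp = Matrix.reindex eA.symm eA.symm (sliceKron (Nf := Nf) (S := L) 1 timeProjPlus) :=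
    (hdict t₀).1
  have hdPm : Pm = Matrix.reindex eA.symm eA.symm (sliceKron (Nf := Nf) (S := L) 1 timeProjMinus) :=
    (hdict t₀).2.1
  have hdW : ∀ t, W t = Matrix.reindex eA.symm eA.symm (sliceGaugeRot (Nf := Nf) (gs t)) :=
    fun t => (hdict t).2.2.1
  have hAB : ∀ t, A t - Bh t =
      Matrix.reindex eA.symm eA.symm (sliceKron (Nf := Nf) (S := L) 1 (euclideanGamma 0) * sliceDiracKinetic (Us t)) :=
    fun t => (hdict t).2.2.2.1
  have hBP : ∀ t, Bh t * Pp = Pp * Bh t := fun t => (hdict t).2.2.2.2.1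
  have hBQ : ∀ t, Bh t * Pm = Pm * Bh t := fun t => (hdict t).2.2.2.2.2.1
  have hPCP : ∀ t, Pp * (A t - Bh t) * Pp = 0 := fun t => (hdict t).2.2.2.2.2.2.1
  have hQCQ : ∀ t, Pm * (A t - Bh t) * Pm = 0 := fun t => (hdict t).2.2.2.2.2.2.2.1
  have hBhdet : ∀ t, IsUnit (Bh t).det := fun t => ((hdict t).2.2.2.2.2.2.2.2 hm).1
  have hBhinv : ∀ t, (Bh t)⁻¹ = Matrix.reindex eA.symm eA.symm (sliceKron ((sliceMassHop (Us t) mq)⁻¹) 1) :=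
    fun t => ((hdict t).2.2.2.2.2.2.2.2 hm).2
  have hcore := fun t => stub_flavourChain_dressedCore Nf L U mq hm t
  have hM' : ∀ t, (1 + Pp * (A t - Bh t) * Pm) * (Bh t * Pp + (Bh t)⁻¹ * Pm) * (1 - Pm * (A t - Bh t) * Pp) =
      Matrix.reindex eA.symm eA.symm (sliceKron (Nf := Nf) 1 (euclideanGamma 0 * gammaFive) *
        fermionSliceMatrix (Us t) mq * sliceKron 1 (gammaFive * euclideanGamma 0)) :=
    fun t => (hcore t).1
  have hMi : (1 + Pm * (A t₀ - Bh t₀) * Pp) * ((Bh t₀)⁻¹ * Pp + Bh t₀ * Pm) * (1 - Pp * (A t₀ - Bh t₀) * Pm) =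
      Matrix.reindex eA.symm eA.symm (sliceKron (Nf := Nf) 1 (euclideanGamma 0 * gammaFive) *
        (fermionSliceMatrix (Us t₀) mq)⁻¹ * sliceKron 1 (gammaFive * euclideanGamma 0)) :=
    (hcore t₀).2.1
  have hdetE : ∀ t, (A t * Pm - Pp * W' (t - 1)).det = (sliceMassHop (Us t) mq).det ^ 2 :=
    fun t => (hcore t).2.2.1
  have hE : ∀ t, IsUnit (A t * Pm - Pp * W' (t - 1)).det := fun t => (hcore t).2.2.2
  /- (3) invertibility of `F_{t₀} = A_{t₀} P⁺ − P⁻ W_{t₀}`: conjunct 3 of the β1 ring identities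
    (`stub_chainBlock_insertion_algebra`), read through determinants. -/
  have h1 : Pp + Pm = 1 := liftProjPlus_add_liftProjMinus (Fin Nf × TorusSite 3 L) 3
  have hPQ : Pp * Pm = 0 := liftProjPlus_mul_liftProjMinus (Fin Nf × TorusSite 3 L) 3
  have hQP : Pm * Pp = 0 := liftProjMinus_mul_liftProjPlus (Fin Nf × TorusSite 3 L) 3
  have hPP : Pp * Pp = Pp := StubWilsonChainUndressInsertion.mul_self_of_add_eq_one h1 hPQ
  have hQQ : Pm * Pm = Pm := StubWilsonChainUndressInsertion.mul_self_of_add_eq_one' h1 hQP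
  have hF : IsUnit (A t₀ * Pp - Pm * W t₀).det := by
    obtain ⟨-, -, h3, -⟩ := stub_chainBlock_insertion_algebra _ Pp Pm (Bh t₀) (Bh t₀)⁻¹ (A t₀ - Bh t₀)
      (W (t₀ - 1)) (W' (t₀ - 1)) (W t₀) (W' t₀) 0 h1 hPP hQQ hPQ hQP (Matrix.mul_nonsing_inv _ (hBhdet t₀))
      (Matrix.nonsing_inv_mul _ (hBhdet t₀)) (hBP t₀) (hBQ t₀) (hPCP t₀) (hQCQ t₀) (hWPp _) (hWPm _)
      (hW'Pp _) (hW'Pm _) (hWPp _) (hWPm _) (hW'Pp _) (hW'Pm _) (hW'W _) (hWW' _) (hW'W _) (hWW' _)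
    rw [add_sub_cancel] at h3
    have hd := congrArg Matrix.det h3
    rw [Matrix.det_mul, Matrix.det_mul, Matrix.det_one] at hd
    exact isUnit_of_mul_isUnit_right (IsUnit.of_mul_eq_one _ hd)
  /- (4) F1: the one-slice source derivative of the chain determinant. -/
  have hF1 := stub_projChain_det_hasDerivAt_source L (Fin Nf × TorusSite 3 L) 3
    (Fintype.card (SliceQuarkVar Nf L)) (eA.trans sliceQuarkEquiv) A W W' t₀ (Matrix.reindex eA.symm eA.symm Jh)
    hWPp hWPm hW'Pp hW'Pm hE hF
  /- (5) F2: undress the temporal transporters (`C_t := A_t − B̂_t`). -/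
  have hF2 := stub_wilsonChain_undress_insertion L (Fin Nf × TorusSite 3 L) 3
    (Fintype.card (SliceQuarkVar Nf L)) (eA.trans sliceQuarkEquiv) Bh (fun t => A t - Bh t) W W' t₀
    (Matrix.reindex eA.symm eA.symm Jh) hBP hBQ hPCP hQCQ hWPp hWPm hW'Pp hW'Pm hW'W hWW' hBhdet
  simp only [add_sub_cancel] at hF2
  rw [← hPp, ← hPm] at hF1 hF2
  /- (6) the dictionary on the undressed side of F2: every one-particle matrix becomes
    `reindex e_Nf e_Nf` of a Smit object. -/
  conv_rhs at hF2 =>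
    simp only [hM', hMi]
    simp only [hAB, hBhinv, hdPp, hdPm, hdW]
  /- (7) the derivative value: F2, the prefactor `∏ det E_t = ∏_i det Â_i²`, and the collapse
    (undressing of `V`, Dirac-sea scalars onto `T̂_F(U_i) = det Â_i² · Γ(M_F(U_i))`). -/
  have hpref : (∏ t, (A t * Pm - Pp * W' (t - 1)).det) =
      ((List.range L).map fun i : ℕ => (sliceMassHop (Us (i : ZMod L)) mq).det ^ 2).prod :=
    (Finset.prod_congr rfl fun t _ => hdetE t).trans (SupertraceTransferForm.prod_univ_zmod_eq L _)
  rw [hF2, hpref] at hF1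
  have hfin := hF1.congr_deriv (StubDetDiracMatrixSourceHasDerivAtSmit.supertrace_collapse L eA
    sliceQuarkEquiv t₀ (sliceKron (Nf := Nf) (S := L) 1 timeProjPlus) (sliceKron (Nf := Nf) (S := L) 1 timeProjMinus)
    (sliceKron (Nf := Nf) (S := L) 1 (euclideanGamma 0 * gammaFive))
    (sliceKron (Nf := Nf) (S := L) 1 (gammaFive * euclideanGamma 0)) Jh
    (sliceKron (Nf := Nf) (S := L) 1 (euclideanGamma 0) * sliceDiracKinetic (Us t₀))
    (sliceKron ((sliceMassHop (Us t₀) mq)⁻¹) 1) ((fermionSliceMatrix (Us t₀) mq)⁻¹)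
    (fun t => fermionSliceMatrix (Us t) mq) (fun t => sliceGaugeRot (Nf := Nf) (gs t))
    (fun t => (sliceMassHop (Us t) mq).det ^ 2)
    SmitTransferForm.gamma50_sliceKron_mul_gamma05_sliceKron
    SliceGammaConjugation.gamma05_sliceKron_mul_gamma50_sliceKron
    (fun t => (sliceKron_one_mul_sliceGaugeRot_comm Nf L (gammaFive * euclideanGamma 0) (gs t)).symm))
  /- (8) the function: γ0 pointwise in `s` (the two `Matrix.of` sources agree definitionally). -/
  have hfun : (fun s : ℝ => (diracMatrix U mq - (s : ℂ) • Matrix.reindex quarkEquiv quarkEquiv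
      (Matrix.of fun v w : QuarkVar Nf L => if v.2.1 0 = t₀ ∧ w.2.1 0 = t₀ then
        Jh (v.1, (Fin.tail v.2.1, v.2.2)) (w.1, (Fin.tail w.2.1, w.2.2)) else 0)).det) =
      fun s : ℝ => (Matrix.of fun p q : ZMod L × ((Fin Nf × TorusSite 3 L) × Fin 3 × Fin 4) =>
        (if q.1 = p.1 then
            (A p.1 - if p.1 = t₀ then (s : ℂ) • Matrix.reindex eA.symm eA.symm Jh else 0) p.2 q.2 else 0) -
          (if q.1 = p.1 + 1 then (Pm * W p.1) p.2 q.2 else 0) -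
          (if p.1 = q.1 + 1 then (Pp * W' q.1) p.2 q.2 else 0)).det := by
    funext s
    exact (hγ (s : ℂ)).1
  rw [hfun]
  unfold fermionSliceOp fockGaugeAct
  exact hfin

end Summit.QuantumFields.QCD.Cruxes.RobustYangMillsHandover.PinTheInfimum
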